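import Literature.Computability.AlgebraicComplexity.BI17WordBlockSignSums
import HarnessLib

/-!
# Block-sign design certificates for rectangular Kronecker positivity `k_m(δ) > 0`

`k_m(δ) = g(m×δ, m×δ, m×δ)` (`kronRect k m δ`, Bürgisser–Ikenmeyer 2017 §5) is the dimension of
`symTripleHw □ □ □`, `□ = (δ,…,δ)` (`m` parts) (`finrank_symTripleHw`, word model). For three block
structures `e₁ e₂ e₃ : Fin (mδ) ≃ Fin δ × Fin m` ("wedge lists", BI 2017 §5; "obstruction
designs" of type `(m×δ)³`, Bürgisser–Ikenmeyer STOC 2013 §4.2; "magic sets" `T ⊆ [δ]³`,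
Amanov–Yeliussizov 2022 §8) the symmetrised product of block signs
`Ψ(ζ_{e₁} ⊗ ζ_{e₂} ⊗ ζ_{e₃}) = sym3 (blockSignTriple k e₁ e₂ e₃)` lies in `symTripleHw □ □ □`
(tree: `blockSignTriple_mem_tripleHw`, `sym3_mem_tripleHw`), so

* §1 `kronRect_pos_of_sum_blockSignTriple_diag_ne_zero`: if the DIAGONAL TRACE
  `∑_u ζ_{e₁}(u) ζ_{e₂}(u) ζ_{e₃}(u)` (= the evaluation of the invariant at the unit tensor `⟨m⟩`:
  a signed count of the proper `m`-colourings of the design, BI 2013 (4.2) / AY 2022 Thm. 8.4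
  `AT_3(δ, T)`) is nonzero then `0 < kronRect k m δ` — the pattern of the tree's
  `kronRect_self_pos_of_latinColCount_ne_zero` (the Latin-square design, `δ = m`) verbatim;
* §2 `sum_blockSignTriple_diag_eq_factorial_mul`: for EVEN `δ` the diagonal trace is `m!` times the
  sum over the colourings NORMALISED on one block of `e₁` (relabelling the `m` letters by `π`
  multiplies each of the `3δ` block signs by `sgn π`, the tree's `wordBlockSign_perm_comp`); for odd `δ` the trace vanishes (not used);
* §3 a verified back-tracking ENUMERATOR `DesignEnum.enum` of the normalised diagonal trace
  (static position order, partial words as reversed lists, conflict pruning read off a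
  precomputed neighbour table whose correctness is a decidable hypothesis), with its soundness
  theorem `DesignEnum.enum_eq_normSum` (private; exported through §4);
* §4 the certificate interface `kronRect_pos_of_enum_ne_zero`;
* §5 a second, PIVOT-MAJOR enumerator `DesignEnum.pivot` for larger designs (branch over the
  letter of the first unconstrained cell of a fixed pivot list, then place the whole class of that
  letter — a "diagonal" of the design, one cell in every block — before the next pivot; states are
  constraint lists; soundness `DesignEnum.pivot_eq_normSum`, private) with its interface
  `kronRect_pos_of_pivot_ne_zero` (§6).

Concrete certificates (e.g. `k_7(6) > 0`, `k_11(6) > 0`, atoms of BI 2017 Ex. 5.6's shape clauses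
for `m = 7, 11`) live in sibling files that instantiate §4 or §6 with explicit tables and close the
enumerator value by `decide`. Honest framing (cell `val-lit`): Derksen/AY-table bookkeeping for `BI2017_ex_5_6`;
nothing here bears on VP versus VNP.

## References

* [BurgisserIkenmeyer2017] P. Bürgisser, C. Ikenmeyer, J. Algebra 477 (2017), §5 (eq. (5.2),
  Thm. 5.9, proof of Thm. 5.13: wedge lists, `P_t`, the zero pattern).
* [BurgisserIkenmeyer2013] P. Bürgisser, C. Ikenmeyer, STOC 2013 = arXiv:1210.8368, §4.2–§4.3
  (obstruction designs, triple labelings (4.2), Ex. 4.10 Latin squares).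
* [AmanovYeliussizov2022] A. Amanov, D. Yeliussizov, *Fundamental invariants of tensors, Latin
  hypercubes, and rectangular Kronecker coefficients*, IMRN 2023 = arXiv:2202.11059, §8
  (Thm. 8.4: for even `k`, `ω^n ≠ 0 ⇔ AT_3(k,T) ≠ 0` for some magic set `T`; Table 4).
-/

noncomputable section

open MvPolynomial

namespace Literature.Computability.AlgebraicComplexity

open _root_.Literature.NumberTheory.DiophantineGeometry

/-! ### §1 The diagonal trace certifies positivity -/

section Bridge

variable (k : Type*) [Field k] [CharZero k] {m δ : ℕ}

omit [CharZero k] in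
/-- The diagonal trace of a symmetrisation: `∑_u (∑_τ H)(u,u,u) = (mδ)! ∑_u H(u,u,u)` (plumbing;
as in `BI17SL3InvariantDimensionProofs`). [folklore] -/
private theorem sum_sym3_diag_eq {n N : ℕ} (H : Word3 N n → k) :
    ∑ u : Word N n, sym3 H ((u, u), u) = (Nat.factorial n : k) * ∑ u : Word N n, H ((u, u), u) := by
  simp only [sym3]
  rw [Finset.sum_comm]
  have h : ∀ τ : Equiv.Perm (Fin n), ∑ u : Word N n, H (permute3 τ ((u, u), u)) =
      ∑ u : Word N n, H ((u, u), u) := by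
    intro τ
    exact Fintype.sum_equiv (Equiv.arrowCongr τ (Equiv.refl (Fin N))).symm _ _ fun u => by
      simp only [permute3, Equiv.arrowCongr_symm]
      rfl
  simp_rw [h]
  rw [Finset.sum_const, Finset.card_univ, Fintype.card_perm, Fintype.card_fin, nsmul_eq_mul]

/-- **A nonzero diagonal trace of a block-sign design certifies `k_m(δ) > 0`.** For block
structures `e₁ e₂ e₃ : Fin (mδ) ≃ Fin δ × Fin m` (`δ` blocks of `m` positions each, letters
`[0,m)`), if `∑_u ζ_{e₁}(u) ζ_{e₂}(u) ζ_{e₃}(u) ≠ 0` — the signed count of the words that carry every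
letter exactly once on every block of each of the three structures (proper colourings of the
obstruction design; BI 2013 (4.2) at the unit tensor, AY 2022 `AT_3`) — then
`Ψ(ζ_{e₁} ⊗ ζ_{e₂} ⊗ ζ_{e₃})` is a nonzero element of `symTripleHw □ □ □`, whose dimension is
`k_m(δ)`. [cite: BurgisserIkenmeyer2017, Thm. 5.9 (proof of (2)) and Thm. 5.13 (proof)]
[cite: AmanovYeliussizov2022, Thm. 8.4] -/
theorem kronRect_pos_of_sum_blockSignTriple_diag_ne_zero (e₁ e₂ e₃ : Fin (m * δ) ≃ Fin δ × Fin m)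
    (h : ∑ u : Word m (m * δ), blockSignTriple k e₁ e₂ e₃ ((u, u), u) ≠ 0) :
    0 < kronRect k m δ := by
  have hmem : sym3 (blockSignTriple k e₁ e₂ e₃) ∈ symTripleHw k m (m * δ)
      (Weight.ofPartition m (Nat.Partition.rectangle m δ))
      (Weight.ofPartition m (Nat.Partition.rectangle m δ))
      (Weight.ofPartition m (Nat.Partition.rectangle m δ)) :=
    (mem_symTripleHw_iff _ _ _ _).2
      ⟨sym3_mem_tripleHw (blockSignTriple_mem_tripleHw k e₁ e₂ e₃), sym3_permute3 _⟩
  have hne : sym3 (blockSignTriple k e₁ e₂ e₃) ≠ 0 := by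
    intro h0
    have hs := sum_sym3_diag_eq k (blockSignTriple k e₁ e₂ e₃)
    rw [h0] at hs
    simp only [Pi.zero_apply, Finset.sum_const_zero] at hs
    exact (mul_ne_zero (Nat.cast_ne_zero.2 (Nat.factorial_ne_zero _)) h) hs.symm
  rw [kronRect, ← finrank_symTripleHw _ _ _ (Nat.Partition.card_parts_rectangle_le m δ)
    (Nat.Partition.card_parts_rectangle_le m δ) (Nat.Partition.card_parts_rectangle_le m δ),
    Module.finrank_pos_iff_exists_ne_zero]
  exact ⟨⟨sym3 (blockSignTriple k e₁ e₂ e₃), hmem⟩, fun h' => hne (congrArg Subtype.val h')⟩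

end Bridge

/-! ### §2 Relabelling the letters: the `m!` quotient for even `δ` -/

section Relabel

variable (k : Type*) [Field k] {m D b : ℕ}

/-- `(sgn π)^b = 1` in `k` for even `b`. [folklore] -/
private theorem sign_pow_even_eq_one (π : Equiv.Perm (Fin m)) (hb : Even b) :
    ((((Equiv.Perm.sign π : ℤˣ) : ℤ) : k) ^ b) = 1 := by
  obtain ⟨c, rfl⟩ := hb
  rw [← two_mul, pow_mul]
  have : ((((Equiv.Perm.sign π : ℤˣ) : ℤ) : k) ^ 2) = 1 := by
    rw [sq, ← Int.cast_mul, ← Units.val_mul, Int.units_mul_self, Units.val_one, Int.cast_one]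
  rw [this, one_pow]

variable {δ : ℕ}

/-- For even `δ`, relabelling the letters does not change `ζ_{e₁}(u)ζ_{e₂}(u)ζ_{e₃}(u)`. [folklore] -/
private theorem blockSignTriple_diag_perm_comp (hδ : Even δ) (e₁ e₂ e₃ : Fin D ≃ Fin δ × Fin m)
    (π : Equiv.Perm (Fin m)) (u : Word m D) :
    blockSignTriple k e₁ e₂ e₃ ((⇑π ∘ u, ⇑π ∘ u), ⇑π ∘ u) = blockSignTriple k e₁ e₂ e₃ ((u, u), u) := by
  simp only [blockSignTriple, wordBlockSign_perm_comp, sign_pow_even_eq_one k π hδ, one_mul]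

/-- A word is NORMALISED on block `b₀` of `e` if it carries the letter `j` at the `j`-th position of
that block. [folklore] -/
private def IsBlockNormalised (e : Fin D ≃ Fin δ × Fin m) (b₀ : Fin δ) (u : Word m D) : Prop :=
  ∀ j : Fin m, u (e.symm (b₀, j)) = j

/-- Normalisation is decidable (plumbing). [folklore] -/
private instance (e : Fin D ≃ Fin δ × Fin m) (b₀ : Fin δ) (u : Word m D) :
    Decidable (IsBlockNormalised e b₀ u) := by
  unfold IsBlockNormalised; infer_instance

/-- **The `m!` quotient.** For even `δ`, the diagonal trace equals `m!` times its restriction to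
the words normalised on a fixed block `b₀` of `e₁`: a word with `ζ_{e₁}(u) ≠ 0` carries a
permutation `σ` of the letters on that block, `u = σ ∘ u'` with `u'` normalised, and
`ζζζ(σ ∘ u') = ζζζ(u')`. [folklore] -/
private theorem sum_blockSignTriple_diag_eq_factorial_mul (hδ : Even δ) (e₁ e₂ e₃ : Fin D ≃ Fin δ × Fin m)
    (b₀ : Fin δ) :
    ∑ u : Word m D, blockSignTriple k e₁ e₂ e₃ ((u, u), u) =
      (Nat.factorial m : k) *
        ∑ u ∈ Finset.univ.filter (IsBlockNormalised e₁ b₀),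
          blockSignTriple k e₁ e₂ e₃ ((u, u), u) := by
  classical
  set P : Word m D → k := fun u => blockSignTriple k e₁ e₂ e₃ ((u, u), u) with hP
  -- (1) each term equals the sum over π of the indicator that π⁻¹ ∘ u is normalised
  have hstep : ∀ u : Word m D, P u =
      ∑ π : Equiv.Perm (Fin m), if IsBlockNormalised e₁ b₀ (⇑π.symm ∘ u) then P u else 0 := by
    intro u
    by_cases hb : Function.Bijective (fun j => u (e₁.symm (b₀, j)))
    · -- exactly one π, namely σ_u, normalises
      set σ : Equiv.Perm (Fin m) := Equiv.ofBijective _ hb with hσ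
      have hnorm : ∀ π : Equiv.Perm (Fin m), IsBlockNormalised e₁ b₀ (⇑π.symm ∘ u) ↔ π = σ := by
        intro π
        constructor
        · intro h
          ext j
          have hj := h j
          simp only [Function.comp_apply] at hj
          -- π.symm (u (e₁.symm (b₀, j))) = j  ⇒ π j = u (…) = σ j
          have h2 : u (e₁.symm (b₀, j)) = π j := by
            have h3 := congrArg (⇑π) hj
            simpa using h3
          rw [← h2]; rfl
        · rintro rfl j
          simp only [Function.comp_apply]
          exact (Equiv.ofBijective _ hb).symm_apply_apply j
      simp_rw [hnorm]
      rw [Finset.sum_ite_eq' Finset.univ σ (fun _ => P u)]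
      simp
    · -- no π normalises, and P u = 0
      have hP0 : P u = 0 := by
        simp only [hP, blockSignTriple]
        have : wordBlockSign k e₁ u = 0 := by
          unfold wordBlockSign
          rw [if_neg]
          exact fun h => hb (h b₀)
        rw [this, zero_mul, zero_mul]
      rw [hP0]
      simp
  -- (2) swap the sums and reindex u = π ∘ u'
  calc ∑ u, P u = ∑ u, ∑ π : Equiv.Perm (Fin m),
        if IsBlockNormalised e₁ b₀ (⇑π.symm ∘ u) then P u else 0 := Finset.sum_congr rfl fun u _ => hstep u
    _ = ∑ π : Equiv.Perm (Fin m), ∑ u,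
        if IsBlockNormalised e₁ b₀ (⇑π.symm ∘ u) then P u else 0 := Finset.sum_comm
    _ = ∑ π : Equiv.Perm (Fin m), ∑ u,
        if IsBlockNormalised e₁ b₀ u then P u else 0 := by
          refine Finset.sum_congr rfl fun π _ => ?_
          -- reindex along u ↦ π.symm ∘ u
          refine Fintype.sum_equiv (Equiv.arrowCongr (Equiv.refl (Fin D)) π.symm) _ _ fun u => ?_
          have hu : (Equiv.arrowCongr (Equiv.refl (Fin D)) π.symm) u = ⇑π.symm ∘ u := by
            funext p; simp [Equiv.arrowCongr_apply]
          rw [hu]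
          by_cases hn : IsBlockNormalised e₁ b₀ (⇑π.symm ∘ u)
          · rw [if_pos hn, if_pos hn]
            have := blockSignTriple_diag_perm_comp k hδ e₁ e₂ e₃ π (⇑π.symm ∘ u)
            have hcomp : ⇑π ∘ (⇑π.symm ∘ u) = u := by
              funext p; simp
            rw [hcomp] at this
            simp only [hP]
            exact this
          · rw [if_neg hn, if_neg hn]
    _ = ∑ _π : Equiv.Perm (Fin m), ∑ u ∈ Finset.univ.filter (IsBlockNormalised e₁ b₀), P u := by
          refine Finset.sum_congr rfl fun π _ => ?_
          rw [Finset.sum_filter]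
    _ = (Nat.factorial m : k) * ∑ u ∈ Finset.univ.filter (IsBlockNormalised e₁ b₀), P u := by
          rw [Finset.sum_const, Finset.card_univ, Fintype.card_perm, Fintype.card_fin, nsmul_eq_mul]

end Relabel

/-! ### §3 A verified enumerator of the normalised diagonal trace -/

namespace DesignEnum

variable {m D δ : ℕ}

/-- The sequence sign as an integer, product over all ordered pairs (computable form of
`Kumar2015.seqSign`). [folklore] -/
def seqSignZ (g : Fin m → Fin m) : ℤ :=
  ∏ p : Fin m, ∏ p' : Fin m, if p < p' then (if g p < g p' then 1 else -1) else 1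

/-- `seqSignZ` is the tree's `seqSign` read in `ℤ` (plumbing). [folklore] -/
private theorem seqSignZ_eq (g : Fin m → Fin m) : seqSignZ g = ((Kumar2015.seqSign g : ℤˣ) : ℤ) := by
  rw [Kumar2015.seqSign_eq_prod_ite, seqSignZ]
  push_cast
  refine Finset.prod_congr rfl fun p _ => Finset.prod_congr rfl fun p' _ => ?_
  split_ifs <;> simp

/-- The integer-valued block sign (the tree's `wordBlockSign` read in `ℤ`). [folklore] -/
def wordBlockSignZ (e : Fin D ≃ Fin δ × Fin m) (u : Word m D) : ℤ :=
  if ∀ a, Function.Bijective (fun j => u (e.symm (a, j))) then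
    ∏ a : Fin δ, seqSignZ (fun j => u (e.symm (a, j))) else 0

/-- `wordBlockSignZ` casts to `wordBlockSign` (plumbing). [folklore] -/
private theorem cast_wordBlockSignZ (k : Type*) [Field k] (e : Fin D ≃ Fin δ × Fin m) (u : Word m D) :
    ((wordBlockSignZ e u : ℤ) : k) = wordBlockSign k e u := by
  unfold wordBlockSignZ wordBlockSign
  split_ifs with h
  · rw [Int.cast_prod]
    exact Finset.prod_congr rfl fun a _ => by rw [seqSignZ_eq]
  · simp

/-- `ζ_{e₁}(u) ζ_{e₂}(u) ζ_{e₃}(u)` in `ℤ`. [folklore] -/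
def tripleZ (e₁ e₂ e₃ : Fin D ≃ Fin δ × Fin m) (u : Word m D) : ℤ :=
  wordBlockSignZ e₁ u * wordBlockSignZ e₂ u * wordBlockSignZ e₃ u

/-- `tripleZ` casts to the diagonal of `blockSignTriple` (plumbing). [folklore] -/
private theorem cast_tripleZ (k : Type*) [Field k] (e₁ e₂ e₃ : Fin D ≃ Fin δ × Fin m) (u : Word m D) :
    ((tripleZ e₁ e₂ e₃ u : ℤ) : k) = blockSignTriple k e₁ e₂ e₃ ((u, u), u) := by
  simp only [tripleZ, blockSignTriple, Int.cast_mul, cast_wordBlockSignZ]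

/-- Two positions lie in a common block of one of the three structures. [folklore] -/
private def SameBlock (e₁ e₂ e₃ : Fin D ≃ Fin δ × Fin m) (p q : Fin D) : Prop :=
  (e₁ p).1 = (e₁ q).1 ∨ (e₂ p).1 = (e₂ q).1 ∨ (e₃ p).1 = (e₃ q).1

/-- Sharing a block is decidable (plumbing). [folklore] -/
private instance (e₁ e₂ e₃ : Fin D ≃ Fin δ × Fin m) (p q : Fin D) :
    Decidable (SameBlock e₁ e₂ e₃ p q) := by
  unfold SameBlock; infer_instance

/-- Sharing a block is symmetric (plumbing). [folklore] -/
private theorem sameBlock_comm (e₁ e₂ e₃ : Fin D ≃ Fin δ × Fin m) {p q : Fin D}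
    (h : SameBlock e₁ e₂ e₃ p q) : SameBlock e₁ e₂ e₃ q p := by
  rcases h with h | h | h
  · exact Or.inl h.symm
  · exact Or.inr (Or.inl h.symm)
  · exact Or.inr (Or.inr h.symm)

section Spec

variable [NeZero m]

/-- The letter at position `p` of a partial word stored as a REVERSED list (most recent letter
first; positions `0, …, w.length - 1` are assigned). [folklore] -/
private def letterOf (w : List (Fin m)) (p : ℕ) : Fin m := w.getD (w.length - 1 - p) 0

/-- Earlier letters are unchanged by extending the word (plumbing). [folklore] -/
private theorem letterOf_cons_of_lt (a : Fin m) (w : List (Fin m)) {p : ℕ} (hp : p < w.length) :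
    letterOf (a :: w) p = letterOf w p := by
  unfold letterOf
  rw [List.length_cons, show w.length + 1 - 1 - p = (w.length - 1 - p) + 1 by omega,
    List.getD_cons_succ]

/-- The newest letter sits at the next position (plumbing). [folklore] -/
private theorem letterOf_cons_length (a : Fin m) (w : List (Fin m)) : letterOf (a :: w) w.length = a := by
  unfold letterOf
  rw [List.length_cons, show w.length + 1 - 1 - w.length = 0 by omega, List.getD_cons_zero]

/-- `u` extends the partial word `w`. [folklore] -/
private def Extends (w : List (Fin m)) (u : Word m D) : Prop :=
  ∀ p : Fin D, p.val < w.length → u p = letterOf w p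

/-- Extension is decidable (plumbing). [folklore] -/
private instance (w : List (Fin m)) (u : Word m D) : Decidable (Extends w u) := by
  unfold Extends; infer_instance

/-- Extending `a :: w` = extending `w` and carrying `a` at the next position (plumbing). [folklore] -/
private theorem extends_cons_iff (a : Fin m) (w : List (Fin m)) (hw : w.length < D) (u : Word m D) :
    Extends (a :: w) u ↔ Extends w u ∧ u ⟨w.length, hw⟩ = a := by
  constructor
  · intro h
    refine ⟨fun p hp => ?_, ?_⟩
    · rw [h p (by rw [List.length_cons]; omega), letterOf_cons_of_lt a w hp]
    · rw [h ⟨w.length, hw⟩ (by rw [List.length_cons]; exact Nat.lt_succ_self _),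
        letterOf_cons_length]
  · rintro ⟨h, ha⟩ p hp
    rw [List.length_cons] at hp
    rcases Nat.lt_succ_iff_lt_or_eq.1 hp with hlt | heq
    · rw [h p hlt, letterOf_cons_of_lt a w hlt]
    · have : p = ⟨w.length, hw⟩ := Fin.ext heq
      subst this
      rw [ha]; exact (letterOf_cons_length a w).symm

variable (e₁ e₂ e₃ : Fin D ≃ Fin δ × Fin m)

/-- The sum over the words extending `w` and normalised on block `b₀` of `e₁`. [folklore] -/
private def partialSum (b₀ : Fin δ) (w : List (Fin m)) : ℤ :=
  ∑ u : Word m D, if Extends w u ∧ IsBlockNormalised e₁ b₀ u then tripleZ e₁ e₂ e₃ u else 0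

/-- The normalised diagonal trace `∑_{u normalised} ζζζ(u)` in `ℤ`. [folklore] -/
private def normSum (b₀ : Fin δ) : ℤ :=
  ∑ u ∈ Finset.univ.filter (IsBlockNormalised e₁ b₀), tripleZ e₁ e₂ e₃ u

/-- The partial sum of the empty prefix is the normalised trace (plumbing). [folklore] -/
private theorem partialSum_nil (b₀ : Fin δ) :
    partialSum e₁ e₂ e₃ b₀ [] = normSum e₁ e₂ e₃ b₀ := by
  unfold partialSum normSum
  rw [Finset.sum_filter]
  refine Finset.sum_congr rfl fun u _ => ?_
  have : Extends ([] : List (Fin m)) u := fun p hp => absurd hp (Nat.not_lt_zero _)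
  simp [this]

/-- Splitting the partial sum by the next letter. [folklore] -/
private theorem partialSum_eq_sum_cons (b₀ : Fin δ) (w : List (Fin m)) (hw : w.length < D) :
    partialSum e₁ e₂ e₃ b₀ w = ∑ a : Fin m, partialSum e₁ e₂ e₃ b₀ (a :: w) := by
  unfold partialSum
  rw [Finset.sum_comm]
  refine Finset.sum_congr rfl fun u _ => ?_
  have E : ∀ a : Fin m, (Extends (a :: w) u ∧ IsBlockNormalised e₁ b₀ u) ↔
      (u ⟨w.length, hw⟩ = a ∧ (Extends w u ∧ IsBlockNormalised e₁ b₀ u)) := fun a => by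
    rw [extends_cons_iff a w hw u]; tauto
  simp_rw [E]
  by_cases hE : Extends w u ∧ IsBlockNormalised e₁ b₀ u
  · simp only [hE, and_true, if_true]
    rw [Finset.sum_ite_eq]
    simp
  · simp only [hE, and_false, if_false, Finset.sum_const_zero]

/-- A conflict kills every extension: if an assigned position `p` in a common block with the next
position carries the next letter `a`, no extension of `a :: w` has three nonzero block signs.
[folklore] -/
private theorem partialSum_cons_eq_zero_of_conflict (b₀ : Fin δ) (w : List (Fin m)) (hw : w.length < D)
    (a : Fin m) (p : Fin D) (hp : p.val < w.length) (hsame : SameBlock e₁ e₂ e₃ p ⟨w.length, hw⟩)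
    (hpa : letterOf w p = a) : partialSum e₁ e₂ e₃ b₀ (a :: w) = 0 := by
  unfold partialSum
  refine Finset.sum_eq_zero fun u _ => ?_
  split_ifs with h
  · obtain ⟨hext, -⟩ := h
    rw [extends_cons_iff a w hw] at hext
    obtain ⟨hext, hun⟩ := hext
    have hup : u p = a := by rw [hext p hp, hpa]
    have hpn : p ≠ ⟨w.length, hw⟩ := fun h => by
      have h' := congrArg Fin.val h
      simp only at h'
      omega
    -- a block of some `eᵢ` carries the letter `a` twice
    have key : ∀ (e : Fin D ≃ Fin δ × Fin m), (e p).1 = (e ⟨w.length, hw⟩).1 →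
        wordBlockSignZ e u = 0 := by
      intro e hb
      unfold wordBlockSignZ
      rw [if_neg]
      intro hbij
      have hinj := (hbij (e p).1).1
      have hj : (e p).2 ≠ (e ⟨w.length, hw⟩).2 := fun hj =>
        hpn (e.injective (Prod.ext hb hj))
      apply hj
      apply hinj
      show u (e.symm ((e p).1, (e p).2)) = u (e.symm ((e p).1, (e ⟨w.length, hw⟩).2))
      rw [Prod.mk.eta, Equiv.symm_apply_apply, hb, Prod.mk.eta, Equiv.symm_apply_apply, hup, hun]
    unfold tripleZ
    rcases hsame with h1 | h2 | h3
    · rw [key e₁ h1, zero_mul, zero_mul]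
    · rw [key e₂ h2, mul_zero, zero_mul]
    · rw [key e₃ h3, mul_zero]
  · rfl

/-- A wrong letter at a normalisation position kills every extension. [folklore] -/
private theorem partialSum_cons_eq_zero_of_ne_forced (b₀ : Fin δ) (w : List (Fin m)) (hw : w.length < D)
    (a : Fin m) (hb : (e₁ ⟨w.length, hw⟩).1 = b₀) (ha : a ≠ (e₁ ⟨w.length, hw⟩).2) :
    partialSum e₁ e₂ e₃ b₀ (a :: w) = 0 := by
  unfold partialSum
  refine Finset.sum_eq_zero fun u _ => ?_
  split_ifs with h
  · exfalso
    obtain ⟨hext, hnorm⟩ := h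
    rw [extends_cons_iff a w hw] at hext
    have h1 := hnorm (e₁ ⟨w.length, hw⟩).2
    rw [← hb, Prod.mk.eta, Equiv.symm_apply_apply, hext.2] at h1
    exact ha h1
  · rfl

/-- Consistency of a partial word: no letter repeated inside a block among the assigned positions,
and the normalisation respected. [folklore] -/
private def Consistent (b₀ : Fin δ) (w : List (Fin m)) : Prop :=
  (∀ p q : Fin D, p.val < w.length → q.val < w.length → p ≠ q → SameBlock e₁ e₂ e₃ p q →
      letterOf w p ≠ letterOf w q) ∧
  (∀ p : Fin D, p.val < w.length → (e₁ p).1 = b₀ → letterOf w p = (e₁ p).2)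

/-- Extending a consistent word by an admissible letter keeps it consistent. [folklore] -/
private theorem consistent_cons (b₀ : Fin δ) (w : List (Fin m)) (hw : w.length < D) (a : Fin m)
    (hc : Consistent e₁ e₂ e₃ b₀ w)
    (hadm : ∀ p : Fin D, p.val < w.length → SameBlock e₁ e₂ e₃ p ⟨w.length, hw⟩ → letterOf w p ≠ a)
    (hforced : (e₁ ⟨w.length, hw⟩).1 = b₀ → a = (e₁ ⟨w.length, hw⟩).2) :
    Consistent e₁ e₂ e₃ b₀ (a :: w) := by
  constructor
  · intro p q hp hq hpq hs
    rw [List.length_cons] at hp hq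
    rcases Nat.lt_succ_iff_lt_or_eq.1 hp with hp' | hp' <;>
      rcases Nat.lt_succ_iff_lt_or_eq.1 hq with hq' | hq'
    · rw [letterOf_cons_of_lt a w hp', letterOf_cons_of_lt a w hq']
      exact hc.1 p q hp' hq' hpq hs
    · have hqe : q = ⟨w.length, hw⟩ := Fin.ext hq'
      subst hqe
      rw [letterOf_cons_of_lt a w hp', letterOf_cons_length]
      exact hadm p hp' hs
    · have hpe : p = ⟨w.length, hw⟩ := Fin.ext hp'
      subst hpe
      rw [letterOf_cons_of_lt a w hq', letterOf_cons_length]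
      exact (hadm q hq' (sameBlock_comm e₁ e₂ e₃ hs)).symm
    · exact absurd (Fin.ext (hp'.trans hq'.symm)) hpq
  · intro p hp hb
    rw [List.length_cons] at hp
    rcases Nat.lt_succ_iff_lt_or_eq.1 hp with hp' | hp'
    · rw [letterOf_cons_of_lt a w hp']; exact hc.2 p hp' hb
    · have hpe : p = ⟨w.length, hw⟩ := Fin.ext hp'
      subst hpe
      rw [letterOf_cons_length]; exact hforced hb

/-- At full length the only extension is the word itself; a consistent full word is normalised.
[folklore] -/
private theorem partialSum_of_length_eq (b₀ : Fin δ) (w : List (Fin m)) (hw : w.length = D)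
    (hc : Consistent e₁ e₂ e₃ b₀ w) :
    partialSum e₁ e₂ e₃ b₀ w = tripleZ e₁ e₂ e₃ (fun p => letterOf w p.val) := by
  unfold partialSum
  have hext : ∀ u : Word m D, Extends w u ↔ u = fun p => letterOf w p.val := fun u =>
    ⟨fun h => funext fun p => h p (by rw [hw]; exact p.isLt), fun h p _ => by rw [h]⟩
  have hnorm : IsBlockNormalised e₁ b₀ (fun p : Fin D => letterOf w p.val) := by
    intro j
    have h := hc.2 (e₁.symm (b₀, j)) (by rw [hw]; exact (e₁.symm (b₀, j)).isLt)
    simp only [Equiv.apply_symm_apply] at h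
    exact h trivial
  simp_rw [hext]
  rw [Finset.sum_eq_single (fun p : Fin D => letterOf w p.val)]
  · rw [if_pos ⟨rfl, hnorm⟩]
  · intro u _ hu
    rw [if_neg]
    exact fun h => hu h.1
  · intro h; exact absurd (Finset.mem_univ _) h

/-- Admissibility of letter `a` at the next position, read off a neighbour table `prev`
(`prev n` lists the earlier positions sharing a block with `n`). [folklore] -/
def adm (prev : Fin D → List (Fin D)) (n : Fin D) (w : List (Fin m)) (a : Fin m) : Bool :=
  (prev n).all fun p => !(decide (w.getD (n.val - 1 - p.val) 0 = a))

/-- Semantics of the admissibility test (plumbing). [folklore] -/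
private theorem adm_eq_true_iff (prev : Fin D → List (Fin D)) (n : Fin D) (w : List (Fin m))
    (hn : w.length = n.val) (a : Fin m) :
    adm prev n w a = true ↔ ∀ p ∈ prev n, letterOf w p.val ≠ a := by
  unfold adm letterOf
  rw [List.all_eq_true]
  simp only [Bool.not_eq_true', decide_eq_false_iff_not, hn]

/-- **The enumerator**: positions are filled in the order `0, 1, …, D-1`; at a normalisation
position only the forced letter is tried; a letter already present in one of the three blocks of
the position is pruned. `fuel + n = D`. [folklore] -/
def enum (prev : Fin D → List (Fin D)) (b₀ : Fin δ) : ℕ → ℕ → List (Fin m) → ℤ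
  | 0, _, w => tripleZ e₁ e₂ e₃ (fun p => w.getD (D - 1 - p.val) 0)
  | fuel + 1, n, w =>
    if h : n < D then
      if (e₁ ⟨n, h⟩).1 = b₀ then
        (if adm prev ⟨n, h⟩ w (e₁ ⟨n, h⟩).2 then
          enum prev b₀ fuel (n + 1) ((e₁ ⟨n, h⟩).2 :: w) else 0)
      else
        ((List.finRange m).map fun a =>
          if adm prev ⟨n, h⟩ w a then enum prev b₀ fuel (n + 1) (a :: w) else 0).sum
    else 0

/-- **Soundness of the enumerator.** On a consistent prefix the enumerator returns the partial sum.
[folklore] -/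
private theorem enum_eq_partialSum (prev : Fin D → List (Fin D))
    (hprev : ∀ n p : Fin D, p ∈ prev n ↔
      (p < n ∧ ((e₁ p).1 = (e₁ n).1 ∨ (e₂ p).1 = (e₂ n).1 ∨ (e₃ p).1 = (e₃ n).1)))
    (b₀ : Fin δ) : ∀ (fuel n : ℕ) (w : List (Fin m)), n + fuel = D → w.length = n →
      Consistent e₁ e₂ e₃ b₀ w → enum e₁ e₂ e₃ prev b₀ fuel n w = partialSum e₁ e₂ e₃ b₀ w := by
  intro fuel
  induction fuel with
  | zero =>
    intro n w hn hw hc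
    rw [Nat.add_zero] at hn
    rw [enum, partialSum_of_length_eq e₁ e₂ e₃ b₀ w (hw.trans hn) hc]
    congr 1
    funext p
    unfold letterOf
    rw [hw, hn]
  | succ fuel ih =>
    intro n w hn hw hc
    have hnD : n < D := by omega
    have hwD : w.length < D := by omega
    have hfin : (⟨n, hnD⟩ : Fin D) = ⟨w.length, hwD⟩ := Fin.ext hw.symm
    rw [enum, dif_pos hnD, partialSum_eq_sum_cons e₁ e₂ e₃ b₀ w hwD]
    -- admissibility ↔ no conflict
    have hadm : ∀ a : Fin m, adm prev ⟨n, hnD⟩ w a = true ↔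
        ∀ p : Fin D, p.val < w.length → SameBlock e₁ e₂ e₃ p ⟨w.length, hwD⟩ →
          letterOf w p ≠ a := by
      intro a
      rw [adm_eq_true_iff prev ⟨n, hnD⟩ w hw a]
      constructor
      · intro h p hp hs
        refine h p ((hprev ⟨n, hnD⟩ p).2 ⟨?_, ?_⟩)
        · exact Fin.lt_def.2 (by simp only; omega)
        · rw [hfin]; exact hs
      · intro h p hp
        obtain ⟨hlt, hs⟩ := (hprev ⟨n, hnD⟩ p).1 hp
        have hlt' := Fin.lt_def.1 hlt
        simp only at hlt'
        refine h p (by omega) ?_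
        rw [← hfin]; exact hs
    -- the value of one branch
    have hbranch : ∀ a : Fin m, ((e₁ ⟨w.length, hwD⟩).1 = b₀ → a = (e₁ ⟨w.length, hwD⟩).2) →
        (if adm prev ⟨n, hnD⟩ w a then enum e₁ e₂ e₃ prev b₀ fuel (n + 1) (a :: w) else 0) =
          partialSum e₁ e₂ e₃ b₀ (a :: w) := by
      intro a hforced
      by_cases ha : adm prev ⟨n, hnD⟩ w a = true
      · rw [if_pos ha]
        exact ih (n + 1) (a :: w) (by omega) (by rw [List.length_cons, hw])
          (consistent_cons e₁ e₂ e₃ b₀ w hwD a hc ((hadm a).1 ha) hforced)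
      · rw [if_neg ha]
        rw [hadm a] at ha
        push Not at ha
        obtain ⟨p, hp, hs, hpa⟩ := ha
        exact (partialSum_cons_eq_zero_of_conflict e₁ e₂ e₃ b₀ w hwD a p hp hs hpa).symm
    by_cases hb : (e₁ ⟨n, hnD⟩).1 = b₀
    · rw [if_pos hb]
      have hb' : (e₁ ⟨w.length, hwD⟩).1 = b₀ := by rw [← hfin]; exact hb
      have hf : (e₁ ⟨n, hnD⟩).2 = (e₁ ⟨w.length, hwD⟩).2 := by rw [hfin]
      rw [hbranch _ (fun _ => hf)]
      rw [Finset.sum_eq_single (e₁ ⟨n, hnD⟩).2]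
      · intro a _ ha
        refine partialSum_cons_eq_zero_of_ne_forced e₁ e₂ e₃ b₀ w hwD a hb' ?_
        rw [← hf]; exact ha
      · intro h; exact absurd (Finset.mem_univ _) h
    · rw [if_neg hb, ← Fin.sum_univ_def]
      refine Finset.sum_congr rfl fun a _ => hbranch a fun hb' => ?_
      exfalso; apply hb; rw [hfin]; exact hb'

/-- **The enumerator computes the normalised diagonal trace.** [folklore] -/
private theorem enum_eq_normSum (prev : Fin D → List (Fin D))
    (hprev : ∀ n p : Fin D, p ∈ prev n ↔
      (p < n ∧ ((e₁ p).1 = (e₁ n).1 ∨ (e₂ p).1 = (e₂ n).1 ∨ (e₃ p).1 = (e₃ n).1)))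
    (b₀ : Fin δ) : enum e₁ e₂ e₃ prev b₀ D 0 [] = normSum e₁ e₂ e₃ b₀ := by
  rw [enum_eq_partialSum e₁ e₂ e₃ prev hprev b₀ D 0 [] (by simp) rfl
    ⟨fun p q hp => absurd hp (Nat.not_lt_zero _), fun p hp => absurd hp (Nat.not_lt_zero _)⟩]
  exact partialSum_nil e₁ e₂ e₃ b₀

end Spec

/-! ### §5 The pivot-major enumerator (whole letter classes)

For larger designs the position-by-position search of §3 does not finish (for the rigid `(11,6)`
design of the cell `val-lit` it has no leaf within `2·10⁷` nodes), because it never uses the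
derived constraint that every letter class of a Latin word is a *diagonal* of the design — one cell
in every block of each of `e₁, e₂, e₃` (the granularity of obstruction designs,
Bürgisser–Ikenmeyer 2013 §4.3; Amanov–Yeliussizov 2022 §8).  The enumerator of this section
branches, at the first unconstrained *pivot* cell of a fixed list, over the letter of that cell
and then places the whole class of that letter — one cell in every block of `e₁`, avoiding cells
and blocks already carrying letters — before turning to the next pivot.  Its soundness is again
purely local: every pruned branch is a sum of `ζζζ(u)` over words violating the Latin or the
normalisation condition, and the split over the cells of one block uses only that a word with
`ζ_{e₁}(u) ≠ 0` is bijective on every block of `e₁`.  States are constraint lists of pairs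
(cell, letter); the block structure enters through two tables `pos`, `sb` supplied (and checked)
by the certificate files. -/

section Pivot

variable (e₁ e₂ e₃ : Fin D ≃ Fin δ × Fin m)

/-- The constrained sum: `∑ ζζζ(u)` over the words normalised on block `b₀` of `e₁` and carrying
the listed letters at the listed cells. [folklore] -/
private def cSum (b₀ : Fin δ) (asg : List (Fin D × Fin m)) : ℤ :=
  ∑ u : Word m D,
    if IsBlockNormalised e₁ b₀ u ∧ ∀ x ∈ asg, u x.1 = x.2 then tripleZ e₁ e₂ e₃ u else 0

/-- The empty constraint list gives the normalised trace (plumbing). [folklore] -/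
private theorem cSum_nil (b₀ : Fin δ) : cSum e₁ e₂ e₃ b₀ [] = normSum e₁ e₂ e₃ b₀ := by
  unfold cSum normSum
  rw [Finset.sum_filter]
  refine Finset.sum_congr rfl fun u _ => if_congr ?_ rfl rfl
  simp

/-- Splitting the constrained sum by the letter of a cell. [folklore] -/
private theorem cSum_eq_sum_letter (b₀ : Fin δ) (asg : List (Fin D × Fin m)) (c : Fin D) :
    cSum e₁ e₂ e₃ b₀ asg = ∑ i : Fin m, cSum e₁ e₂ e₃ b₀ ((c, i) :: asg) := by
  unfold cSum
  rw [Finset.sum_comm]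
  refine Finset.sum_congr rfl fun u _ => ?_
  by_cases hN : IsBlockNormalised e₁ b₀ u ∧ ∀ x ∈ asg, u x.1 = x.2
  · rw [if_pos hN, Finset.sum_eq_single (u c)]
    · rw [if_pos]
      exact ⟨hN.1, List.forall_mem_cons.2 ⟨rfl, hN.2⟩⟩
    · intro i _ hi
      rw [if_neg]
      rintro ⟨-, h⟩
      exact hi (List.forall_mem_cons.1 h).1.symm
    · intro h; exact absurd (Finset.mem_univ _) h
  · rw [if_neg hN]
    symm
    refine Finset.sum_eq_zero fun i _ => ?_
    rw [if_neg]
    rintro ⟨h1, h2⟩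
    exact hN ⟨h1, (List.forall_mem_cons.1 h2).2⟩

/-- Splitting the constrained sum by the cell of block `b` of `e₁` that carries the letter `i`:
words with `ζ_{e₁} ≠ 0` are bijective on the block, the others contribute `0`. [folklore] -/
private theorem cSum_eq_sum_rank (b₀ : Fin δ) (asg : List (Fin D × Fin m)) (i : Fin m) (b : Fin δ) :
    cSum e₁ e₂ e₃ b₀ asg = ∑ j : Fin m, cSum e₁ e₂ e₃ b₀ ((e₁.symm (b, j), i) :: asg) := by
  unfold cSum
  rw [Finset.sum_comm]
  refine Finset.sum_congr rfl fun u _ => ?_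
  by_cases hN : IsBlockNormalised e₁ b₀ u ∧ ∀ x ∈ asg, u x.1 = x.2
  · rw [if_pos hN]
    by_cases hbij : ∀ a, Function.Bijective (fun j => u (e₁.symm (a, j)))
    · obtain ⟨j₀, hj₀, huniq⟩ := (hbij b).existsUnique i
      rw [Finset.sum_eq_single j₀]
      · rw [if_pos]
        exact ⟨hN.1, List.forall_mem_cons.2 ⟨hj₀, hN.2⟩⟩
      · intro j _ hj
        rw [if_neg]
        rintro ⟨-, h⟩
        exact hj (huniq j (List.forall_mem_cons.1 h).1)
      · intro h; exact absurd (Finset.mem_univ _) h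
    · have ht : tripleZ e₁ e₂ e₃ u = 0 := by
        unfold tripleZ wordBlockSignZ
        rw [if_neg hbij, zero_mul, zero_mul]
      rw [ht]
      symm
      exact Finset.sum_eq_zero fun j _ => ite_self 0
  · rw [if_neg hN]
    symm
    refine Finset.sum_eq_zero fun j _ => ?_
    rw [if_neg]
    rintro ⟨h1, h2⟩
    exact hN ⟨h1, (List.forall_mem_cons.1 h2).2⟩

/-- A constraint already present may be repeated (plumbing). [folklore] -/
private theorem cSum_cons_of_mem (b₀ : Fin δ) (asg : List (Fin D × Fin m)) {x : Fin D × Fin m}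
    (hx : x ∈ asg) : cSum e₁ e₂ e₃ b₀ (x :: asg) = cSum e₁ e₂ e₃ b₀ asg := by
  unfold cSum
  refine Finset.sum_congr rfl fun u _ => if_congr ?_ rfl rfl
  rw [List.forall_mem_cons]
  exact ⟨fun ⟨h1, _, h3⟩ => ⟨h1, h3⟩, fun ⟨h1, h3⟩ => ⟨h1, h3 x hx, h3⟩⟩

/-- Two different letters at one cell: empty sum. [folklore] -/
private theorem cSum_cons_eq_zero_of_clash (b₀ : Fin δ) (asg : List (Fin D × Fin m))
    {x : Fin D × Fin m} (hx : x ∈ asg) {p : Fin D} {i : Fin m} (hp : x.1 = p) (hi : x.2 ≠ i) :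
    cSum e₁ e₂ e₃ b₀ ((p, i) :: asg) = 0 := by
  unfold cSum
  refine Finset.sum_eq_zero fun u _ => ?_
  rw [if_neg]
  rintro ⟨-, h⟩
  rw [List.forall_mem_cons] at h
  apply hi
  rw [← h.2 x hx, hp]
  exact h.1

/-- One letter at two cells of a common block: every such word has `ζζζ(u) = 0`. [folklore] -/
private theorem tripleZ_eq_zero_of_eq (u : Word m D) {p q : Fin D} (hne : p ≠ q) (huq : u p = u q)
    (hs : SameBlock e₁ e₂ e₃ p q) : tripleZ e₁ e₂ e₃ u = 0 := by
  have key : ∀ (e : Fin D ≃ Fin δ × Fin m), (e p).1 = (e q).1 → wordBlockSignZ e u = 0 := by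
    intro e hb
    unfold wordBlockSignZ
    rw [if_neg]
    intro hbij
    have hinj := (hbij (e p).1).1
    have hj : (e p).2 ≠ (e q).2 := fun hj => hne (e.injective (Prod.ext hb hj))
    apply hj
    apply hinj
    show u (e.symm ((e p).1, (e p).2)) = u (e.symm ((e p).1, (e q).2))
    rw [Prod.mk.eta, Equiv.symm_apply_apply, hb, Prod.mk.eta, Equiv.symm_apply_apply, huq]
  unfold tripleZ
  rcases hs with h1 | h2 | h3
  · rw [key e₁ h1, zero_mul, zero_mul]
  · rw [key e₂ h2, mul_zero, zero_mul]
  · rw [key e₃ h3, mul_zero]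

/-- A letter already present in a block of the new cell: empty sum. [folklore] -/
private theorem cSum_cons_eq_zero_of_sameBlock (b₀ : Fin δ) (asg : List (Fin D × Fin m))
    {x : Fin D × Fin m} (hx : x ∈ asg) {p : Fin D} {i : Fin m} (hi : x.2 = i) (hne : x.1 ≠ p)
    (hs : SameBlock e₁ e₂ e₃ x.1 p) : cSum e₁ e₂ e₃ b₀ ((p, i) :: asg) = 0 := by
  unfold cSum
  refine Finset.sum_eq_zero fun u _ => ?_
  split_ifs with h
  · obtain ⟨-, hall⟩ := h
    rw [List.forall_mem_cons] at hall
    have hup : u p = i := hall.1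
    have hux : u x.1 = i := (hall.2 x hx).trans hi
    exact tripleZ_eq_zero_of_eq e₁ e₂ e₃ u hne (hux.trans hup.symm) hs
  · rfl

/-- A wrong letter at a normalisation cell: empty sum. [folklore] -/
private theorem cSum_cons_eq_zero_of_ne_forced (b₀ : Fin δ) (asg : List (Fin D × Fin m))
    {p : Fin D} {i : Fin m} (hb : (e₁ p).1 = b₀) (hi : i ≠ (e₁ p).2) :
    cSum e₁ e₂ e₃ b₀ ((p, i) :: asg) = 0 := by
  unfold cSum
  refine Finset.sum_eq_zero fun u _ => ?_
  rw [if_neg]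
  rintro ⟨hnorm, h⟩
  rw [List.forall_mem_cons] at h
  have h1 := hnorm (e₁ p).2
  rw [← hb, Prod.mk.eta, Equiv.symm_apply_apply] at h1
  exact hi (h.1.symm.trans h1)

/-- **Class filling** (inner search of the pivot-major enumerator): for the letter `i`, choose in
every listed block of `e₁` the cell carrying `i` — skipping cells constrained to another letter
and cells sharing a block with a cell already carrying `i` — and continue with `k` on the
extended constraint list. [folklore] -/
def fill (pos : Fin δ → Fin m → Fin D) (sb : Fin D → Fin D → Bool) (b₀ : Fin δ) (i : Fin m) :
    List (Fin δ) → List (Fin D × Fin m) → (List (Fin D × Fin m) → ℤ) → ℤ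
  | [], asg, k => k asg
  | b :: bs, asg, k =>
    ((List.finRange m).map fun j =>
      if b = b₀ ∧ j ≠ i then 0 else
        match asg.find? (fun x => decide (x.1 = pos b j)) with
        | some x => if x.2 = i then fill pos sb b₀ i bs asg k else 0
        | none =>
          if asg.any (fun x => decide (x.2 = i) && sb x.1 (pos b j)) then 0
          else fill pos sb b₀ i bs ((pos b j, i) :: asg) k).sum

variable (pos : Fin δ → Fin m → Fin D) (hpos : ∀ b j, pos b j = e₁.symm (b, j))
  (sb : Fin D → Fin D → Bool) (hsb : ∀ p q, sb p q = true ↔ SameBlock e₁ e₂ e₃ p q)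

include hpos hsb in
/-- Soundness of class filling: if the continuation is correct on every extension of the
constraint list, `fill` returns the constrained sum. [folklore] -/
private theorem fill_eq_cSum (b₀ : Fin δ) (i : Fin m) :
    ∀ (bs : List (Fin δ)) (asg : List (Fin D × Fin m)) (k : List (Fin D × Fin m) → ℤ),
      (∀ asg', (∀ x ∈ asg, x ∈ asg') → k asg' = cSum e₁ e₂ e₃ b₀ asg') →
      fill pos sb b₀ i bs asg k = cSum e₁ e₂ e₃ b₀ asg := by
  intro bs
  induction bs with
  | nil => intro asg k hk; exact hk asg fun x hx => hx
  | cons b bs ih =>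
    intro asg k hk
    rw [fill, cSum_eq_sum_rank e₁ e₂ e₃ b₀ asg i b, Fin.sum_univ_def]
    congr 1
    refine List.map_congr_left fun j _ => ?_
    rw [← hpos b j]
    -- the term for rank `j` equals `cSum ((pos b j, i) :: asg)`
    by_cases hforced : b = b₀ ∧ j ≠ i
    · rw [if_pos hforced]
      symm
      refine cSum_cons_eq_zero_of_ne_forced e₁ e₂ e₃ b₀ asg ?_ ?_
      · rw [hpos, Equiv.apply_symm_apply]; exact hforced.1
      · rw [hpos, Equiv.apply_symm_apply]; exact hforced.2.symm
    rw [if_neg hforced]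
    cases hf : asg.find? (fun x => decide (x.1 = pos b j)) with
    | some x =>
      have hxm : x ∈ asg := List.mem_of_find?_eq_some hf
      have hxp : x.1 = pos b j := by simpa using List.find?_some hf
      simp only
      by_cases hxi : x.2 = i
      · rw [if_pos hxi, ih asg k hk]
        have : (pos b j, i) = x := Prod.ext hxp.symm hxi.symm
        rw [this, cSum_cons_of_mem e₁ e₂ e₃ b₀ asg hxm]
      · rw [if_neg hxi]
        exact (cSum_cons_eq_zero_of_clash e₁ e₂ e₃ b₀ asg hxm hxp hxi).symm
    | none =>
      simp only
      by_cases hany : (asg.any fun x => decide (x.2 = i) && sb x.1 (pos b j)) = true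
      · rw [if_pos hany]
        obtain ⟨x, hxm, hx⟩ := List.any_eq_true.1 hany
        rw [Bool.and_eq_true, decide_eq_true_eq, hsb] at hx
        have hne : x.1 ≠ pos b j := fun h => by
          rw [List.find?_eq_none] at hf
          exact hf x hxm (by simpa using h)
        exact (cSum_cons_eq_zero_of_sameBlock e₁ e₂ e₃ b₀ asg hxm hx.1 hne hx.2).symm
      · rw [if_neg hany]
        exact ih _ k fun asg' h => hk asg' fun x hx => h x (List.mem_cons_of_mem _ hx)

variable [NeZero m]

/-- The word read off a constraint list (letter `0` at unconstrained cells). [folklore] -/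
def readOff (asg : List (Fin D × Fin m)) : Word m D := fun p =>
  match asg.find? (fun x => decide (x.1 = p)) with
  | some x => x.2
  | none => 0

/-- The leaf value: `ζζζ` of the read-off word if it satisfies every constraint and is
normalised on block `b₀` (read through the cell table `pos`), else `0`. [folklore] -/
def leafVal (b₀ : Fin δ) (asg : List (Fin D × Fin m)) : ℤ :=
  if (asg.all fun x => decide (readOff asg x.1 = x.2)) &&
      ((List.finRange m).all fun j => decide (readOff asg (pos b₀ j) = j)) then
    tripleZ e₁ e₂ e₃ (readOff asg) else 0

include hpos in
/-- A satisfied constraint list constraining every cell has the single solution `readOff`.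
[folklore] -/
private theorem cSum_eq_leafVal (b₀ : Fin δ) (asg : List (Fin D × Fin m))
    (hcov : ∀ p : Fin D, ∃ x ∈ asg, x.1 = p) :
    cSum e₁ e₂ e₃ b₀ asg = leafVal e₁ e₂ e₃ pos b₀ asg := by
  -- any word satisfying the constraints is `readOff asg`
  have huniq : ∀ u : Word m D, (∀ x ∈ asg, u x.1 = x.2) → u = readOff asg := by
    intro u hu
    funext p
    unfold readOff
    obtain ⟨x, hx, hxp⟩ := hcov p
    cases hf : asg.find? (fun x => decide (x.1 = p)) with
    | none =>
      exfalso
      rw [List.find?_eq_none] at hf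
      exact hf x hx (by simpa using hxp)
    | some y =>
      have hy := List.find?_some hf
      have hyp : y.1 = p := by simpa using hy
      simp only
      rw [← hyp]
      exact hu y (List.mem_of_find?_eq_some hf)
  have hsat : (asg.all fun x => decide (readOff asg x.1 = x.2)) = true ↔
      ∀ x ∈ asg, readOff asg x.1 = x.2 := by
    rw [List.all_eq_true]; simp only [decide_eq_true_eq]
  have hnormb : ((List.finRange m).all fun j => decide (readOff asg (pos b₀ j) = j)) = true ↔
      IsBlockNormalised e₁ b₀ (readOff asg) := by
    rw [List.all_eq_true]
    simp only [List.mem_finRange, true_implies, decide_eq_true_eq, hpos]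
    rfl
  unfold cSum leafVal
  by_cases hgood : IsBlockNormalised e₁ b₀ (readOff asg) ∧ ∀ x ∈ asg, readOff asg x.1 = x.2
  · rw [Finset.sum_eq_single (readOff asg)]
    · rw [if_pos hgood, if_pos]
      rw [Bool.and_eq_true, hsat, hnormb]
      exact ⟨hgood.2, hgood.1⟩
    · intro u _ hu
      rw [if_neg]
      rintro ⟨-, h⟩
      exact hu (huniq u h)
    · intro h; exact absurd (Finset.mem_univ _) h
  · rw [if_neg (show ¬ ((asg.all fun x => decide (readOff asg x.1 = x.2)) &&
        ((List.finRange m).all fun j => decide (readOff asg (pos b₀ j) = j))) = true from fun h => by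
          rw [Bool.and_eq_true, hsat, hnormb] at h
          exact hgood ⟨h.2, h.1⟩)]
    refine Finset.sum_eq_zero fun u _ => ?_
    rw [if_neg]
    rintro ⟨h1, h2⟩
    have := huniq u h2
    subst this
    exact hgood ⟨h1, h2⟩

/-- **The pivot-major enumerator**: take the first cell of `ord` not yet constrained, branch over
its letter (forced on block `b₀`; letters present in one of its three blocks pruned), fill the
whole class of that letter, repeat; at the end evaluate the leaf. `fuel` bounds the number of
pivots. [folklore] -/
def pivot (ord : List (Fin D)) (b₀ : Fin δ) : ℕ → List (Fin D × Fin m) → ℤ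
  | 0, asg => leafVal e₁ e₂ e₃ pos b₀ asg
  | fuel + 1, asg =>
    match ord.find? (fun c => !(asg.any fun x => decide (x.1 = c))) with
    | none => leafVal e₁ e₂ e₃ pos b₀ asg
    | some c =>
      ((List.finRange m).map fun i =>
        if (e₁ c).1 = b₀ ∧ i ≠ (e₁ c).2 then 0
        else if asg.any (fun x => decide (x.2 = i) && sb x.1 c) then 0
        else fill pos sb b₀ i ((List.finRange δ).filter fun b => b ≠ (e₁ c).1) ((c, i) :: asg)
          (pivot ord b₀ fuel)).sum

/-- The cells not constrained by a list (the fuel measure). [folklore] -/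
private def uncov (asg : List (Fin D × Fin m)) : Finset (Fin D) :=
  Finset.univ.filter fun p => ∀ x ∈ asg, x.1 ≠ p

include hpos hsb in
/-- **Soundness of the pivot-major enumerator.** [folklore] -/
private theorem pivot_eq_cSum (ord : List (Fin D)) (hord : ∀ p, p ∈ ord) (b₀ : Fin δ) :
    ∀ (fuel : ℕ) (asg : List (Fin D × Fin m)), (uncov asg).card ≤ fuel →
      pivot e₁ e₂ e₃ pos sb ord b₀ fuel asg = cSum e₁ e₂ e₃ b₀ asg := by
  -- coverage from an empty `uncov`, and from `find? = none`
  have hcov_of : ∀ asg : List (Fin D × Fin m), (∀ c ∈ ord, (asg.any fun x => decide (x.1 = c)) = true) →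
      ∀ p : Fin D, ∃ x ∈ asg, x.1 = p := by
    intro asg h p
    obtain ⟨x, hx, hxp⟩ := List.any_eq_true.1 (h p (hord p))
    exact ⟨x, hx, by simpa using hxp⟩
  have hnone : ∀ asg : List (Fin D × Fin m),
      ord.find? (fun c => !(asg.any fun x => decide (x.1 = c))) = none →
      pivot e₁ e₂ e₃ pos sb ord b₀ 0 asg = cSum e₁ e₂ e₃ b₀ asg ∧
        leafVal e₁ e₂ e₃ pos b₀ asg = cSum e₁ e₂ e₃ b₀ asg := by
    intro asg hf
    rw [List.find?_eq_none] at hf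
    have hc := hcov_of asg fun c hc => by simpa using hf c hc
    exact ⟨(cSum_eq_leafVal e₁ e₂ e₃ pos hpos b₀ asg hc).symm,
      (cSum_eq_leafVal e₁ e₂ e₃ pos hpos b₀ asg hc).symm⟩
  intro fuel
  induction fuel with
  | zero =>
    intro asg hcard
    have hc : ∀ p : Fin D, ∃ x ∈ asg, x.1 = p := by
      intro p
      by_contra h
      have hp : p ∈ uncov asg := by
        unfold uncov; rw [Finset.mem_filter]
        exact ⟨Finset.mem_univ _, fun x hx hxp => h ⟨x, hx, hxp⟩⟩
      have := Finset.card_pos.2 ⟨p, hp⟩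
      omega
    show leafVal e₁ e₂ e₃ pos b₀ asg = _
    exact (cSum_eq_leafVal e₁ e₂ e₃ pos hpos b₀ asg hc).symm
  | succ fuel ih =>
    intro asg hcard
    rw [pivot]
    cases hf : ord.find? (fun c => !(asg.any fun x => decide (x.1 = c))) with
    | none => simp only; exact (hnone asg hf).2
    | some c =>
      simp only
      have hc : ∀ x ∈ asg, x.1 ≠ c := by
        intro x hx hxc
        have h := List.find?_some hf
        simp only [Bool.not_eq_true', List.any_eq_false] at h
        exact h x hx (by simpa using hxc)
      rw [cSum_eq_sum_letter e₁ e₂ e₃ b₀ asg c, Fin.sum_univ_def]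
      congr 1
      refine List.map_congr_left fun i _ => ?_
      by_cases hforced : (e₁ c).1 = b₀ ∧ i ≠ (e₁ c).2
      · rw [if_pos hforced]
        exact (cSum_cons_eq_zero_of_ne_forced e₁ e₂ e₃ b₀ asg hforced.1 hforced.2).symm
      rw [if_neg hforced]
      by_cases hany : (asg.any fun x => decide (x.2 = i) && sb x.1 c) = true
      · rw [if_pos hany]
        obtain ⟨x, hxm, hx⟩ := List.any_eq_true.1 hany
        rw [Bool.and_eq_true, decide_eq_true_eq, hsb] at hx
        exact (cSum_cons_eq_zero_of_sameBlock e₁ e₂ e₃ b₀ asg hxm hx.1 (hc x hxm) hx.2).symm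
      · rw [if_neg hany]
        refine fill_eq_cSum e₁ e₂ e₃ pos hpos sb hsb b₀ i _ _ _ fun asg' hsub => ih asg' ?_
        -- the pivot `c` is constrained in `asg'`, so the measure dropped
        have hsubset : uncov asg' ⊆ (uncov asg).erase c := by
          intro p hp
          unfold uncov at hp ⊢
          rw [Finset.mem_filter] at hp
          rw [Finset.mem_erase, Finset.mem_filter]
          refine ⟨fun hpc => hp.2 (c, i) (hsub _ List.mem_cons_self) hpc.symm,
            Finset.mem_univ _, fun x hx => hp.2 x (hsub x (List.mem_cons_of_mem _ hx))⟩
        have hcmem : c ∈ uncov asg := by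
          unfold uncov; rw [Finset.mem_filter]; exact ⟨Finset.mem_univ _, hc⟩
        have := Finset.card_le_card hsubset
        rw [Finset.card_erase_of_mem hcmem] at this
        omega

include hpos hsb in
/-- **The pivot-major enumerator computes the normalised diagonal trace.** [folklore] -/
private theorem pivot_eq_normSum (ord : List (Fin D)) (hord : ∀ p, p ∈ ord) (b₀ : Fin δ) :
    pivot e₁ e₂ e₃ pos sb ord b₀ D [] = normSum e₁ e₂ e₃ b₀ := by
  rw [pivot_eq_cSum e₁ e₂ e₃ pos hpos sb hsb ord hord b₀ D []
    ((Finset.card_le_univ _).trans (Fintype.card_fin D).le), cSum_nil]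

end Pivot

end DesignEnum

/-! ### §4 The certificate interface -/

section Certificate

variable (k : Type*) [Field k] [CharZero k] {m δ : ℕ} [NeZero m]

/-- **Design certificate ⇒ `k_m(δ) > 0`** (even `δ`): three block structures on `mδ` positions, a
correct neighbour table, and a nonzero value of the enumerator (a kernel computation in the
certificate files) give `0 < kronRect k m δ`.
[cite: BurgisserIkenmeyer2017, Thm. 5.9 (proof of (2))] [cite: AmanovYeliussizov2022, Thm. 8.4] -/
theorem kronRect_pos_of_enum_ne_zero (hδ : Even δ) (e₁ e₂ e₃ : Fin (m * δ) ≃ Fin δ × Fin m)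
    (b₀ : Fin δ) (prev : Fin (m * δ) → List (Fin (m * δ)))
    (hprev : ∀ n p : Fin (m * δ), p ∈ prev n ↔
      (p < n ∧ ((e₁ p).1 = (e₁ n).1 ∨ (e₂ p).1 = (e₂ n).1 ∨ (e₃ p).1 = (e₃ n).1)))
    (h : DesignEnum.enum e₁ e₂ e₃ prev b₀ (m * δ) 0 [] ≠ 0) : 0 < kronRect k m δ := by
  apply kronRect_pos_of_sum_blockSignTriple_diag_ne_zero k e₁ e₂ e₃
  rw [sum_blockSignTriple_diag_eq_factorial_mul k hδ e₁ e₂ e₃ b₀]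
  refine mul_ne_zero (Nat.cast_ne_zero.2 (Nat.factorial_ne_zero _)) ?_
  have hcast : ∑ u ∈ Finset.univ.filter (IsBlockNormalised e₁ b₀),
      blockSignTriple k e₁ e₂ e₃ ((u, u), u) = ((DesignEnum.normSum e₁ e₂ e₃ b₀ : ℤ) : k) := by
    rw [DesignEnum.normSum, Int.cast_sum]
    exact Finset.sum_congr rfl fun u _ => (DesignEnum.cast_tripleZ k e₁ e₂ e₃ u).symm
  rw [hcast, ← DesignEnum.enum_eq_normSum e₁ e₂ e₃ prev hprev b₀, Int.cast_ne_zero]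
  exact h

/-! ### §6 The pivot-major certificate interface -/

/-- **Pivot-major design certificate ⇒ `k_m(δ) > 0`** (even `δ`): three block structures on `mδ`
cells, a cell table `pos` and a same-block table `sb` agreeing with them, a pivot list containing
every cell, and a nonzero value of the pivot-major enumerator (a kernel computation in the
certificate files) give `0 < kronRect k m δ`.
[cite: BurgisserIkenmeyer2017, Thm. 5.9 (proof of (2))] [cite: AmanovYeliussizov2022, Thm. 8.4] -/
theorem kronRect_pos_of_pivot_ne_zero (hδ : Even δ) (e₁ e₂ e₃ : Fin (m * δ) ≃ Fin δ × Fin m)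
    (b₀ : Fin δ) (pos : Fin δ → Fin m → Fin (m * δ)) (hpos : ∀ b j, pos b j = e₁.symm (b, j))
    (sb : Fin (m * δ) → Fin (m * δ) → Bool)
    (hsb : ∀ p q, sb p q = true ↔
      ((e₁ p).1 = (e₁ q).1 ∨ (e₂ p).1 = (e₂ q).1 ∨ (e₃ p).1 = (e₃ q).1))
    (ord : List (Fin (m * δ))) (hord : ∀ p, p ∈ ord)
    (h : DesignEnum.pivot e₁ e₂ e₃ pos sb ord b₀ (m * δ) [] ≠ 0) : 0 < kronRect k m δ := by
  apply kronRect_pos_of_sum_blockSignTriple_diag_ne_zero k e₁ e₂ e₃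
  rw [sum_blockSignTriple_diag_eq_factorial_mul k hδ e₁ e₂ e₃ b₀]
  refine mul_ne_zero (Nat.cast_ne_zero.2 (Nat.factorial_ne_zero _)) ?_
  have hcast : ∑ u ∈ Finset.univ.filter (IsBlockNormalised e₁ b₀),
      blockSignTriple k e₁ e₂ e₃ ((u, u), u) = ((DesignEnum.normSum e₁ e₂ e₃ b₀ : ℤ) : k) := by
    rw [DesignEnum.normSum, Int.cast_sum]
    exact Finset.sum_congr rfl fun u _ => (DesignEnum.cast_tripleZ k e₁ e₂ e₃ u).symm
  rw [hcast, ← DesignEnum.pivot_eq_normSum e₁ e₂ e₃ pos hpos sb hsb ord hord b₀, Int.cast_ne_zero]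
  exact h

end Certificate

end Literature.Computability.AlgebraicComplexity
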